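import Summits.QuantumFields.BalabanUV.T4Continuum.Support.NE7TensionLetterOfRadius
import Summits.QuantumFields.BalabanUV.T4Continuum.Support.NE3GaugeDirFrames
import HarnessLib

/-!
# NE7TensionRadiusOfFluxGradient — THE DICTIONARY «TENSION RADIUS ⇐ FLUX-GRADIENT RADIUS»: each summand of the tension `T_ν(x) = Σ_μ ∇_μ^† B_{μν}(x)` is (up to an isometric transport
# and a sign) the covariant forward gradient of the flux at `x − e_μ`, so `‖covGrad U (flux U)‖ ≤ g` (row NE3's class datum, F123d's `hgW`∕`hgU`) gives `‖T_ν(x)‖ ≤ d·g` at every bond;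
# with F140: `|dAction U ψ (perWin d P)| ≤ (d·g + 12·#Plane·a²)·‖ψ‖₁` for every skew periodic `ψ` — F137∕F139's tension letter `τ_W` is a CLASS DATUM of the live END (file 71)

Cell `pub-balaban`, rung (B)+1 sub-cell t4, lineage `b2b-balaban-t4-ne7-p1` (CRUX PROVER NE7 #1 = OWNER of row NE7), generation 80; memo
`t4/b2b-balaban-t4-ne7-p1-g80/SLICE-LETTER-OBSTRUCTION.md` §8.  File F141, over F140 `NE7TensionLetterOfRadius.abs_dAction_le_of_tension_sup`, `NE3GaugeDirFrames.Ad_Ad_inv`,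
`T4AveragingDeficitNonAbelian.Ad_sub`, `AveragingDeficitNearIdentity.Ad_neg`, `AveragingDeficitTransport.norm_Ad_of_unitary`.
WHAT ([folklore]; 0 def, 0 sorry).  §1 `norm_cDstar_eq_norm_covGrad_shape` (`‖Ad_{U(y,μ)}⁻¹ g(y) − g(y+e_μ)‖ = ‖Ad_{U(y,μ)} g(y+e_μ) − g(y)‖`); §2 **`norm_tension_le_of_fluxGrad`**
(`‖T_ν(x)‖ ≤ d·g`); §3 **`abs_dAction_le_of_fluxGrad`** (`|dAction U ψ (perWin d P)| ≤ (d·g + 12·#Plane·a²)·dirL1 ψ (periodBox P)`).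
HONEST FRAMING (page 1): elementary bookkeeping at one configuration; nothing of Bałaban's asserted; NOT ONE-STEP, NOT NE7; spine 0∕9; finite T⁴ rung (B)+1 — NOT infinite volume, NOT mass
gap, NOT `BetaPertH`, NOT Clay.  Continuum YM on T⁴ ⇐ BetaPertH ∧ nine spine estimates (0/9 proved); BetaPertH ⇐ (D1) ∧ (D4) ∧ CAP+tail; G-an2-4 gates asym, D1 and NE2/3/4.
-/

set_option autoImplicit false

open scoped BigOperators Matrix Matrix.Norms.L2Operator
open NormedSpace Finset

namespace Summit.QuantumFields.BalabanUV.T4Continuum.NE7TensionRadiusOfFluxGradient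

open Literature.MathematicalPhysics.QuantumFieldTheory.Balaban1983to89
open B7Prop1Explicit B7Prop2Explicit MatrixLog UnitaryModel
open T4AveragingDeficitWall (IsUnitaryCfg IsSkewDir SmallField dirL1 Ad flux covGrad)
open T4AveragingDeficitWallBoundary (IsPeriodicCfg periodBox)
open T4AveragingDeficitNonAbelian (Ad_sub)
open AveragingDeficitPeriodicCounting (IsPeriodicDir)
open AveragingDeficitNearIdentity (Ad_neg)
open AveragingDeficitTransport (norm_Ad_of_unitary)
open MinimalActionLevels (perWin)
open NE3HessForm (dAction)
open NE3CovariantCalculus (cDstar)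
open NE3GaugeDirFrames (Ad_Ad_inv)
open NE7TensionLetterOfRadius (abs_dAction_le_of_tension_sup)

noncomputable section

variable {d : ℕ} {n : Type*} [Fintype n] [DecidableEq n]

/-! ## §1 The codifferential summand is a transported forward gradient -/

/-- `‖Ad_{u}⁻¹ A − C‖ = ‖Ad_u C − A‖` for unitary `u`. [folklore] -/
theorem norm_Ad_inv_sub_eq [Nonempty n] {u : (Matrix n n ℂ)ˣ} (hu : u ∈ unitaryUnits (Matrix n n ℂ)) (A C : Matrix n n ℂ) :
    ‖Ad u⁻¹ A - C‖ = ‖Ad u C - A‖ := by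
  have h : Ad u (Ad u⁻¹ A - C) = A - Ad u C := by rw [Ad_sub, Ad_Ad_inv]
  rw [← norm_Ad_of_unitary hu (Ad u⁻¹ A - C), h, norm_sub_rev]

/-! ## §2 The tension radius from the flux-gradient radius -/

/-- **`‖T_ν(x)‖ ≤ d·g`**: `U` unitary, `B` the antisymmetrised flux form, `‖covGrad U (flux U) z κ π‖ ≤ g` at every bond and plane (`g ≥ 0`) ⟹
`‖Σ_μ cDstar U μ (B · μ ν) x‖ ≤ d·g` at every bond. [folklore] -/
theorem norm_tension_le_of_fluxGrad [Nonempty n] {U : Site d → Fin d → (Matrix n n ℂ)ˣ} (hU : IsUnitaryCfg U)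
    {B : Site d → Fin d → Fin d → Matrix n n ℂ}
    (hBF : ∀ (x : Site d) (μ ν : Fin d) (h : μ < ν), B x μ ν = flux U (x, ⟨(μ, ν), h⟩))
    (hanti : ∀ (x : Site d) (μ ν : Fin d), B x ν μ = -B x μ ν)
    {g : ℝ} (hg0 : 0 ≤ g) (hg : ∀ (z : Site d) (κ : Fin d) (π : T4AveragingDeficitWall.Plane d), ‖covGrad U (flux U) z κ π‖ ≤ g)
    (x : Site d) (ν : Fin d) :
    ‖∑ μ : Fin d, cDstar U μ (fun y => B y μ ν) x‖ ≤ (d : ℝ) * g := by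
  -- each summand is bounded by `g`
  have hterm : ∀ μ : Fin d, ‖cDstar U μ (fun y => B y μ ν) x‖ ≤ g := by
    intro μ
    unfold NE3CovariantCalculus.cDstar
    rw [norm_Ad_inv_sub_eq (hU (x - e μ) μ)]
    show ‖Ad (U (x - e μ) μ) (B x μ ν) - B (x - e μ) μ ν‖ ≤ g
    rcases lt_trichotomy μ ν with hlt | heq | hgt
    · -- `μ < ν`: `B = flux(π_{μν})`
      have h1 : B x μ ν = flux U (x, ⟨(μ, ν), hlt⟩) := hBF x μ ν hlt
      have h2 : B (x - e μ) μ ν = flux U (x - e μ, ⟨(μ, ν), hlt⟩) := hBF (x - e μ) μ ν hlt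
      have h := hg (x - e μ) μ ⟨(μ, ν), hlt⟩
      unfold T4AveragingDeficitWall.covGrad at h
      rw [sub_add_cancel] at h
      rw [h1, h2]
      exact h
    · -- `μ = ν`: the antisymmetrised form vanishes on the diagonal
      subst heq
      have hzero : ∀ y, B y μ μ = 0 := fun y => by
        have h := hanti y μ μ
        have h2 : (2 : ℂ) • B y μ μ = 0 := by
          rw [two_smul]; nth_rewrite 1 [h]; exact neg_add_cancel _
        exact (smul_eq_zero.mp h2).resolve_left (by norm_num)
      rw [hzero, hzero, AveragingDeficitNearIdentity.Ad_zero, sub_zero, norm_zero]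
      exact hg0
    · -- `ν < μ`: `B = −flux(π_{νμ})`
      have h1 : B x μ ν = -flux U (x, ⟨(ν, μ), hgt⟩) := by rw [hanti x ν μ, hBF x ν μ hgt]
      have h2 : B (x - e μ) μ ν = -flux U (x - e μ, ⟨(ν, μ), hgt⟩) := by rw [hanti (x - e μ) ν μ, hBF (x - e μ) ν μ hgt]
      have h := hg (x - e μ) μ ⟨(ν, μ), hgt⟩
      unfold T4AveragingDeficitWall.covGrad at h
      rw [sub_add_cancel] at h
      rw [h1, h2, Ad_neg, ← neg_sub', norm_neg]
      exact h
  calc ‖∑ μ : Fin d, cDstar U μ (fun y => B y μ ν) x‖ ≤ ∑ μ : Fin d, ‖cDstar U μ (fun y => B y μ ν) x‖ := norm_sum_le _ _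
    _ ≤ ∑ _μ : Fin d, g := Finset.sum_le_sum fun μ _ => hterm μ
    _ = (d : ℝ) * g := by rw [Finset.sum_const, Finset.card_univ, Fintype.card_fin, nsmul_eq_mul]

/-! ## §3 The integrated tension letter from the flux-gradient radius -/

/-- **THE TENSION LETTER OF F137∕F139 FROM THE CLASS DATUM `‖covGrad U (flux U)‖ ≤ g`**: `P ≥ 1`, `U` unitary `P`-periodic, `SmallField U a` (`0 ≤ a ≤ 1∕4`), `B` the antisymmetrised
flux form ⟹ for every skew `P`-periodic `ψ`: `|dAction U ψ (perWin d P)| ≤ (d·g + 12·#Plane·a²)·dirL1 ψ (periodBox P)`. [folklore] -/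
theorem abs_dAction_le_of_fluxGrad [Nonempty n] {P : ℕ} (hP : 1 ≤ P) {U : Site d → Fin d → (Matrix n n ℂ)ˣ} (hU : IsUnitaryCfg U) (hUP : IsPeriodicCfg U (P : ℤ))
    {a : ℝ} (ha0 : 0 ≤ a) (ha : a ≤ 1 / 4) (hUa : SmallField U a)
    {B : Site d → Fin d → Fin d → Matrix n n ℂ}
    (hBF : ∀ (x : Site d) (μ ν : Fin d) (h : μ < ν), B x μ ν = flux U (x, ⟨(μ, ν), h⟩))
    (hanti : ∀ (x : Site d) (μ ν : Fin d), B x ν μ = -B x μ ν)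
    {g : ℝ} (hg0 : 0 ≤ g) (hg : ∀ (z : Site d) (κ : Fin d) (π : T4AveragingDeficitWall.Plane d), ‖covGrad U (flux U) z κ π‖ ≤ g)
    {ψ : Site d → Fin d → Matrix n n ℂ} (hψs : IsSkewDir ψ) (hψP : IsPeriodicDir ψ (P : ℤ)) :
    |dAction U ψ (perWin d P)| ≤ ((d : ℝ) * g + 12 * (Fintype.card (T4AveragingDeficitWall.Plane d) : ℝ) * a ^ 2) * dirL1 ψ (periodBox (d := d) P) :=
  abs_dAction_le_of_tension_sup hP hU hUP ha0 ha hUa hBF hanti (norm_tension_le_of_fluxGrad hU hBF hanti hg0 hg) hψs hψP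

end

end Summit.QuantumFields.BalabanUV.T4Continuum.NE7TensionRadiusOfFluxGradient
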